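import Literature.MathematicalPhysics.QuantumFieldTheory.Balaban1983to89.B8Eq191FlatDirichletForm

/-!
# `Balaban1983to89.B8Eq191FlatTowerGram` — [Balaban1985RegularSpaces] (1.91) p. 91 AT `U₀ = 1`: the TOWER GRAM MATRIX `Q′G′(1)²Q′ᵀ` of
# `H′ = G′²Q′*(Q′G′²Q′*)⁻¹` on a finite Dirichlet region is a UNIT — [B6] p. 235 «Of course the operator `Q′G′²Q′*` is positive definite, so its
# inverse is well defined», PROVED for the flat Dirichlet `G′(1)` of `B8Eq191FlatDirichletForm` and DISJOINT tower blocks meeting the region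

statement-level skeleton of published theorems with citation tags; proofs where landed; nothing here is a claim about the
Yang–Mills mass gap

T. Bałaban, *Spaces of regular gauge field configurations on a lattice and gauge fixing conditions*, Commun. Math. Phys. **99** (1985) 75–102
`[Balaban1985RegularSpaces]` ("B8"), (1.91) p. 91 («`H′ = G′²Q′*(Q′G′²Q′*)⁻¹`, `G′ = (Δ + Q′*aQ′)⁻¹`»); [4] = `[Balaban1985BackgroundPropagators]` (3.19) p. 393,
(3.24)–(3.25) p. 394; [B6] = `[Balaban1984PropagatorsII]` p. 235.

CITATION HEADER (lean-in-tree rule).  Cell `pub-ymgap` (YM Track A, HUMAN RULING D-0062), DAG node N05 = [B8], seat `pub-ymgap-dag-n05-e` (g3; director-ym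
R141 (C), FAN-OUT §N05 row s3b successor — THE FLAT CURRENCY for Proposition 6).  Third real-linear-algebra module of the flat letters at `U₀ = 1`
(`B8Eq191FlatStencils` → `B8Eq191FlatDirichletForm` → this): the letter `C = (Q′G′²Q′ᵀ)⁻¹` of the N05 socket (`B8SockLettersRD.SockLettersRD`, law
«`Q′G′²Q′ᵀC(Q′f) = Q′f`», [4] (3.25)) needs the tower Gram matrix to be invertible.  With `K` the flat Dirichlet kernel (a letter with its defining
equation `hK`), `S ⊂ ℤᵈ` the finite region, `B` a finite set of tower indices `(j, y)` and the flat averaging matrix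
`Q(p, z) = L^{−dj}[y_j(z) = y]` (`p = (j, y)`, the matrix of `Q′_j(1)` on `S`-supported fields, `B8Eq191FlatStencils.QprimeIter_flat_eq_sum_of_supp`):
* §1 `K` is symmetric (`flatKernel_symm`), hence so are its matrix and the inverse matrix `G′(1)` (`flatMatrix_transpose`, `flatMatrix_inv_transpose`);
* §2 `Qᵀ` has injective `mulVec` when the tower blocks indexed by `B` are pairwise disjoint on `S` and each meets `S` (`towerQT_mulVec_injective`);
* §3 ★ `isUnit_towerGram`: `Q·G′(1)·G′(1)·Qᵀ` is a unit (`uᵀQG′G′Qᵀu = |G′Qᵀu|²`).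

HONEST SCOPE.  Finite-dimensional real linear algebra; no estimate; nothing of [4] ∕ [B6] beyond the quoted positivity sentence.  Count-neutral; N05 NOT
discharged; one finite `T⁴` programme at fixed `ε`, Bałaban as printed; nothing continuum ∕ ℝ⁴ ∕ OS ∕ mass-gap ∕ Clay.  No `sorry`, no `def`, no `instance`,
no `notation`.  Unit `pub-ymgap-dag-n05-e` (g3), 2026-08-27.
-/

noncomputable section

namespace Literature.MathematicalPhysics.QuantumFieldTheory.Balaban1983to89.B8Eq191FlatTowerGram

open Finset
open scoped Matrix
open B7Prop1Explicit (e)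
open Literature.MathematicalPhysics.QuantumLattice (blockMap)
open B8Eq191FlatDirichletForm (isUnit_flatMatrix)

variable {d : ℕ}

/-! ## §1 Symmetry of the flat Dirichlet kernel and of `G′(1)` -/

open Classical in
/-- **The flat Dirichlet kernel is symmetric**: `K(x, z) = K(z, x)`. [cite: Balaban1985BackgroundPropagators, (3.23)–(3.24) p.394] -/
theorem flatKernel_symm {η : ℝ} (L m : ℕ) (Λs : ℕ → Set (Fin d → ℤ)) (a : ℕ → ℝ) (K : (Fin d → ℤ) → (Fin d → ℤ) → ℝ)
    (hK : ∀ x z, K x z = ((η ^ 2)⁻¹ * ∑ μ : Fin d, ((2 : ℝ) * (if z = x then (1 : ℝ) else 0) - (if z = x + e μ then (1 : ℝ) else 0)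
        - (if z = x - e μ then (1 : ℝ) else 0))) +
        (∑ j ∈ Finset.range (m + 1), (if blockMap (L ^ j) x ∈ Λs j ∧ blockMap (L ^ j) z = blockMap (L ^ j) x then
          a j * ((((L : ℝ) ^ d)⁻¹) ^ j) ^ 2 else 0)))
    (x z : Fin d → ℤ) : K x z = K z x := by
  rw [hK, hK]
  congr 1
  · congr 1
    refine Finset.sum_congr rfl fun μ _ => ?_
    have h1 : (z = x) ↔ (x = z) := eq_comm
    have h2 : (z = x + e μ) ↔ (x = z - e μ) := by
      constructor
      · intro h; rw [h, add_sub_cancel_right]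
      · intro h; rw [h, sub_add_cancel]
    have h3 : (z = x - e μ) ↔ (x = z + e μ) := by
      constructor
      · intro h; rw [h, sub_add_cancel]
      · intro h; rw [h, add_sub_cancel_right]
    simp only [h1, h2, h3]
    ring
  · refine Finset.sum_congr rfl fun j _ => ?_
    by_cases h : blockMap (L ^ j) x ∈ Λs j ∧ blockMap (L ^ j) z = blockMap (L ^ j) x
    · rw [if_pos h, if_pos ⟨h.2 ▸ h.1, h.2.symm⟩]
    · rw [if_neg h, if_neg (fun h' : blockMap (L ^ j) z ∈ Λs j ∧ blockMap (L ^ j) x = blockMap (L ^ j) z =>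
        h ⟨h'.2 ▸ h'.1, h'.2.symm⟩)]

open Classical in
/-- The flat Dirichlet matrix is symmetric. [cite: Balaban1985BackgroundPropagators, (3.24) p.394] -/
theorem flatMatrix_transpose {η : ℝ} (L m : ℕ) (Λs : ℕ → Set (Fin d → ℤ)) (a : ℕ → ℝ) (K : (Fin d → ℤ) → (Fin d → ℤ) → ℝ)
    (hK : ∀ x z, K x z = ((η ^ 2)⁻¹ * ∑ μ : Fin d, ((2 : ℝ) * (if z = x then (1 : ℝ) else 0) - (if z = x + e μ then (1 : ℝ) else 0)
        - (if z = x - e μ then (1 : ℝ) else 0))) +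
        (∑ j ∈ Finset.range (m + 1), (if blockMap (L ^ j) x ∈ Λs j ∧ blockMap (L ^ j) z = blockMap (L ^ j) x then
          a j * ((((L : ℝ) ^ d)⁻¹) ^ j) ^ 2 else 0)))
    (S : Finset (Fin d → ℤ)) :
    (Matrix.of fun x z : ↥S => K x.1 z.1)ᵀ = Matrix.of fun x z : ↥S => K x.1 z.1 := by
  ext x z
  simp only [Matrix.transpose_apply, Matrix.of_apply]
  exact flatKernel_symm L m Λs a K hK z.1 x.1

open Classical in
/-- **`G′(1)` is symmetric**: the inverse of the flat Dirichlet matrix is its own transpose. [cite: Balaban1985RegularSpaces, (1.95) p.92; Balaban1985BackgroundPropagators, (3.24) p.394] -/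
theorem flatMatrix_inv_transpose {η : ℝ} (L m : ℕ) (Λs : ℕ → Set (Fin d → ℤ)) (a : ℕ → ℝ) (K : (Fin d → ℤ) → (Fin d → ℤ) → ℝ)
    (hK : ∀ x z, K x z = ((η ^ 2)⁻¹ * ∑ μ : Fin d, ((2 : ℝ) * (if z = x then (1 : ℝ) else 0) - (if z = x + e μ then (1 : ℝ) else 0)
        - (if z = x - e μ then (1 : ℝ) else 0))) +
        (∑ j ∈ Finset.range (m + 1), (if blockMap (L ^ j) x ∈ Λs j ∧ blockMap (L ^ j) z = blockMap (L ^ j) x then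
          a j * ((((L : ℝ) ^ d)⁻¹) ^ j) ^ 2 else 0)))
    (S : Finset (Fin d → ℤ)) :
    ((Matrix.of fun x z : ↥S => K x.1 z.1)⁻¹)ᵀ = (Matrix.of fun x z : ↥S => K x.1 z.1)⁻¹ := by
  rw [Matrix.transpose_nonsing_inv, flatMatrix_transpose L m Λs a K hK S]

/-! ## §2 The flat averaging matrix on the tower indices: `Qᵀ` is injective for disjoint towers -/

/-- **`Q′(1)ᵀ` IS INJECTIVE ON THE TOWER SPACE** when the tower blocks indexed by `B` are pairwise disjoint on `S` and each meets `S`: with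
`Q(p, z) = L^{−dj}[y_j(z) = y]` for `p = (j, y) ∈ B`, `z ∈ S`, the map `u ↦ Qᵀu` has trivial kernel.
[cite: Balaban1985BackgroundPropagators, (3.19) p.393, (3.24) p.394; Balaban1984PropagatorsII, p.235] -/
theorem towerQT_mulVec_injective {L : ℕ} (hL : 1 ≤ L) (S : Finset (Fin d → ℤ)) (B : Finset (ℕ × (Fin d → ℤ)))
    (hmeet : ∀ p ∈ B, ∃ z ∈ S, blockMap (L ^ p.1) z = p.2)
    (hdisj : ∀ p ∈ B, ∀ p' ∈ B, ∀ z ∈ S, blockMap (L ^ p.1) z = p.2 → blockMap (L ^ p'.1) z = p'.2 → p = p') :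
    Function.Injective
      (Matrix.of fun (p : ↥B) (z : ↥S) => if blockMap (L ^ p.1.1) z.1 = p.1.2 then (((L : ℝ) ^ d)⁻¹) ^ p.1.1 else 0)ᵀ.mulVec := by
  set Q : Matrix ↥B ↥S ℝ := Matrix.of fun (p : ↥B) (z : ↥S) =>
    if blockMap (L ^ p.1.1) z.1 = p.1.2 then (((L : ℝ) ^ d)⁻¹) ^ p.1.1 else 0 with hQ
  have hL0 : (0 : ℝ) < L := by exact_mod_cast hL
  -- it suffices to treat the kernel
  suffices hker : ∀ u : ↥B → ℝ, Qᵀ.mulVec u = 0 → u = 0 by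
    intro u₁ u₂ h
    have h0 : Qᵀ.mulVec (u₁ - u₂) = 0 := by rw [Matrix.mulVec_sub, h, sub_self]
    exact sub_eq_zero.mp (hker _ h0)
  intro u hu
  funext p
  obtain ⟨z, hzS, hz⟩ := hmeet p.1 p.2
  have hrow := congrFun hu ⟨z, hzS⟩
  simp only [Matrix.mulVec, dotProduct, Matrix.transpose_apply, Pi.zero_apply] at hrow
  -- only the index `p` contributes at the site `z`
  rw [Finset.sum_eq_single p] at hrow
  · rw [hQ, Matrix.of_apply, if_pos hz] at hrow
    have hc : (((L : ℝ) ^ d)⁻¹) ^ p.1.1 ≠ 0 := by positivity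
    exact (mul_eq_zero.mp hrow).resolve_left hc
  · intro p' _ hp'
    rw [hQ, Matrix.of_apply]
    by_cases h' : blockMap (L ^ p'.1.1) z = p'.1.2
    · exact absurd (Subtype.ext (hdisj p'.1 p'.2 p.1 p.2 z hzS h' hz)) hp'
    · rw [if_neg h', zero_mul]
  · intro hp
    exact absurd (Finset.mem_univ p) hp

/-! ## §3 The tower Gram matrix `Q·G′(1)·G′(1)·Qᵀ` is a unit -/

open Classical in
/-- **[B6] p. 235 FOR THE FLAT DIRICHLET `G′(1)`: `Q′G′²Q′ᵀ` IS A UNIT ON THE TOWER SPACE** (`uᵀ(QG′G′Qᵀ)u = |G′Qᵀu|²`, `G′` symmetric and a unit,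
`Qᵀ` injective for disjoint towers meeting the region) — the existence of the letter `C = (Q′G′²Q′ᵀ)⁻¹` of (1.91) ∕ [4] (3.25) at `U₀ = 1`.
[cite: Balaban1985RegularSpaces, (1.91) p.91; Balaban1984PropagatorsII, p.235; Balaban1985BackgroundPropagators, (3.25) p.394] -/
theorem isUnit_towerGram (hd : 0 < d) {η : ℝ} (hη : η ≠ 0) {L : ℕ} (hL : 1 ≤ L) (m : ℕ) (Λs : ℕ → Set (Fin d → ℤ)) (a : ℕ → ℝ)
    (ha : ∀ j, 0 ≤ a j) (K : (Fin d → ℤ) → (Fin d → ℤ) → ℝ)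
    (hK : ∀ x z, K x z = ((η ^ 2)⁻¹ * ∑ μ : Fin d, ((2 : ℝ) * (if z = x then (1 : ℝ) else 0) - (if z = x + e μ then (1 : ℝ) else 0)
        - (if z = x - e μ then (1 : ℝ) else 0))) +
        (∑ j ∈ Finset.range (m + 1), (if blockMap (L ^ j) x ∈ Λs j ∧ blockMap (L ^ j) z = blockMap (L ^ j) x then
          a j * ((((L : ℝ) ^ d)⁻¹) ^ j) ^ 2 else 0)))
    (S : Finset (Fin d → ℤ)) (B : Finset (ℕ × (Fin d → ℤ)))
    (hmeet : ∀ p ∈ B, ∃ z ∈ S, blockMap (L ^ p.1) z = p.2)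
    (hdisj : ∀ p ∈ B, ∀ p' ∈ B, ∀ z ∈ S, blockMap (L ^ p.1) z = p.2 → blockMap (L ^ p'.1) z = p'.2 → p = p') :
    IsUnit ((Matrix.of fun (p : ↥B) (z : ↥S) => if blockMap (L ^ p.1.1) z.1 = p.1.2 then (((L : ℝ) ^ d)⁻¹) ^ p.1.1 else 0) *
      (Matrix.of fun x z : ↥S => K x.1 z.1)⁻¹ * (Matrix.of fun x z : ↥S => K x.1 z.1)⁻¹ *
      (Matrix.of fun (p : ↥B) (z : ↥S) => if blockMap (L ^ p.1.1) z.1 = p.1.2 then (((L : ℝ) ^ d)⁻¹) ^ p.1.1 else 0)ᵀ) := by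
  set Q : Matrix ↥B ↥S ℝ := Matrix.of fun (p : ↥B) (z : ↥S) =>
    if blockMap (L ^ p.1.1) z.1 = p.1.2 then (((L : ℝ) ^ d)⁻¹) ^ p.1.1 else 0 with hQ
  set T : Matrix ↥S ↥S ℝ := Matrix.of fun x z : ↥S => K x.1 z.1 with hT
  have hTunit : IsUnit T := isUnit_flatMatrix hd hη L m Λs a ha K hK S
  have hGi : IsUnit T⁻¹ := (Matrix.isUnit_nonsing_inv_iff).mpr hTunit
  have hGi_inj : Function.Injective T⁻¹.mulVec := Matrix.mulVec_injective_iff_isUnit.mpr hGi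
  have hGi_symm : (T⁻¹)ᵀ = T⁻¹ := flatMatrix_inv_transpose L m Λs a K hK S
  have hQT_inj := towerQT_mulVec_injective (d := d) hL S B hmeet hdisj
  refine Matrix.mulVec_injective_iff_isUnit.mp ?_
  -- kernel argument
  suffices hker : ∀ u : ↥B → ℝ, (Q * T⁻¹ * T⁻¹ * Qᵀ).mulVec u = 0 → u = 0 by
    intro u₁ u₂ h
    have h0 : (Q * T⁻¹ * T⁻¹ * Qᵀ).mulVec (u₁ - u₂) = 0 := by rw [Matrix.mulVec_sub, h, sub_self]
    exact sub_eq_zero.mp (hker _ h0)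
  intro u hu
  -- `w = G′Qᵀu` has `|w|² = uᵀ(QG′G′Qᵀ)u = 0`
  set w : ↥S → ℝ := (T⁻¹ * Qᵀ).mulVec u with hw
  have hsplit : (Q * T⁻¹ * T⁻¹ * Qᵀ).mulVec u = (Q * T⁻¹).mulVec w := by
    rw [hw, Matrix.mulVec_mulVec, ← Matrix.mul_assoc]
  have hQG : Q * T⁻¹ = (T⁻¹ * Qᵀ)ᵀ := by
    rw [Matrix.transpose_mul, Matrix.transpose_transpose, hGi_symm]
  have hww : w ⬝ᵥ w = 0 := by
    have h1 : u ⬝ᵥ ((Q * T⁻¹ * T⁻¹ * Qᵀ).mulVec u) = 0 := by rw [hu, dotProduct_zero]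
    rw [hsplit, hQG, Matrix.dotProduct_mulVec, Matrix.vecMul_transpose] at h1
    rw [← hw] at h1
    exact h1
  have hw0 : w = 0 := dotProduct_self_eq_zero.mp hww
  have hQu : Qᵀ.mulVec u = 0 := by
    apply hGi_inj
    rw [Matrix.mulVec_zero, Matrix.mulVec_mulVec, ← hw, hw0]
  exact hQT_inj (by rw [hQu, Matrix.mulVec_zero])

end Literature.MathematicalPhysics.QuantumFieldTheory.Balaban1983to89.B8Eq191FlatTowerGram

end
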